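import Mathlib.LinearAlgebra.Matrix.Charpoly.Eigs
import Mathlib.LinearAlgebra.Matrix.Rank
import Literature.NumberTheory.GaloisRepresentations.ArtinEulerFactorProofs
import Literature.NumberTheory.GaloisRepresentations.ArtinConductor
import HarnessLib

/-!
# The contragredient of a finite-image framed representation (proofs)

For a framed representation `ρ : G →ₜ* GL_n(ℂ)` with **finite image** and its dual
`ρ^∨ = FramedRep.dual ρ : g ↦ ((ρ g)ᵀ)⁻¹` (`Literature.NumberTheory.GaloisRepresentations.ContinuousRep`)
we prove the elementary facts used in step (ii)–(iii) of the proof of Deligne–Serre,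
*Formes modulaires de poids 1*, Ann. Sci. ÉNS (4) 7 (1974), Thm. 4.6 (pp. 515–516), where the
functional equation `ζ(1 - s, ρ) = v ζ(s, ρ̄)` relates `ρ` to its complex conjugate
`ρ̄ ≃ ρ^∨` (decomposition of the named fact `Literature.NumberTheory.Automorphic.artinConductorNat_eq_level`, top layer
`Literature.NumberTheory.Automorphic.LanglandsTunnellProofs`):

* `Matrix.charpoly_inv_eq_map_conj_of_pow_eq_one` — for `A ∈ M₂(ℂ)` of finite order,
  `charpoly (A⁻¹) = conj (charpoly A)` (the eigenvalues are roots of unity, `λ⁻¹ = λ̄`);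
  hence `Literature.NumberTheory.GaloisRepresentations.FramedGaloisRep.hasFrobCharpolyAt_dual`: if the Frobenii at `v` have
  characteristic polynomial `P` on `ρ`, they have characteristic polynomial `P̄` on `ρ^∨`
  (e.g. `X² - ā_p X + ε̄(p)` from `X² - a_p X + ε(p)`).
* `Literature.NumberTheory.GaloisRepresentations.FramedGaloisRep.isUnramifiedAt_dual`, `Literature.NumberTheory.GaloisRepresentations.FramedGaloisRep.isOdd_dual`,
  `Literature.NumberTheory.GaloisRepresentations.FramedRep.finite_range_dual` — `ρ^∨` is unramified where `ρ` is, odd if `ρ` is, and has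
  finite image if `ρ` has.
* `Literature.NumberTheory.GaloisRepresentations.FramedRep.finrank_fixedSubmodule_eq_rank` — for finite image, `dim V^H = rank (Σ_{g ∈ ρ(H)} g)`
  (the fixed vectors of the finite group `ρ(H)` are the range of the unnormalised averaging
  operator); since `Σ_{g ∈ ρ^∨(H)} g = (Σ_{g ∈ ρ(H)} g)ᵀ` has the same rank,
  `dim V^{H}(ρ^∨) = dim V^{H}(ρ)` (`finrank_fixedSubmodule_dual`) for **every** subgroup `H`, and
  therefore all Artin/Swan conductors of `ρ^∨` and `ρ` agree:
  `Literature.NumberTheory.GaloisRepresentations.FramedGaloisRep.artinConductorNat_dual` (`GaloisRep.artinConductorNat`, which only sees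
  `ρ` through the codimensions `codim V^H`, `GaloisRep.artinConductorNat_congr_codimFixed`).
  This is "`M` est le conducteur de `ρ`" being also the conductor of `ρ̄` in op. cit. (ii).

Everything here is proved.

## References

* P. Deligne, J.-P. Serre, *Formes modulaires de poids 1*, Ann. Sci. ÉNS (4) 7 (1974),
  §4 (b), proof of Thm. 4.6, (ii)–(iii) (`DeligneSerreASENS1974`).
* J.-P. Serre, *Linear representations of finite groups*, GTM 42, §1.4 (contragredient),
  §2.1 Prop. 1 and §2.3 (eigenvalues are roots of unity, `χ^∨ = χ̄`, `dim V^G` by averaging).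
* J.-P. Serre, *Local Fields*, Ch. VI §2 (the conductor depends only on the `codim V^{G_i}`).
-/

noncomputable section

open scoped NumberField MatrixGroups Matrix
open Field IsDedekindDomain Module NumberField Polynomial

/-! ### Finite-order `2 × 2` matrices: `charpoly (A⁻¹) = conj (charpoly A)` -/

namespace Matrix

/-- The roots of the characteristic polynomial of a complex matrix of finite order
(`A ^ m = 1`, `m > 0`) have absolute value `1`: they are eigenvalues of `toLin' A`, an
endomorphism of finite order.  Ref: Serre, *Linear representations of finite groups*, §2.1,
proof of Prop. 1. [folklore] -/
theorem norm_eq_one_of_mem_roots_charpoly_of_pow_eq_one {n : Type*} [Fintype n] [DecidableEq n]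
    {A : Matrix n n ℂ} {m : ℕ} (hm : 0 < m) (hA : A ^ m = 1) {μ : ℂ}
    (hμ : μ ∈ A.charpoly.roots) : ‖μ‖ = 1 := by
  have hroot : IsRoot (Matrix.toLin' A).charpoly μ := by
    rw [Matrix.charpoly_toLin']
    exact (mem_roots A.charpoly_monic.ne_zero).mp hμ
  have hpow : (Matrix.toLin' A) ^ m = 1 := by
    rw [← Matrix.toLin'_pow, hA, Matrix.toLin'_one, Module.End.one_eq_id]
  exact Literature.NumberTheory.GaloisRepresentations.norm_eq_one_of_hasEigenvalue_of_pow_eq_one hm hpow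
    ((Module.End.hasEigenvalue_iff_isRoot_charpoly _ _).mpr hroot)

/-- **Characteristic polynomial of the inverse of a finite-order `2 × 2` complex matrix.**  If
`A ^ m = 1` (`m > 0`) then `charpoly (A⁻¹) = conj (charpoly A)`: with `λ₁, λ₂` the roots of
`charpoly A = X² - (tr A) X + det A` one has `|λ_i| = 1`, so
`tr A⁻¹ = (λ₁ + λ₂)/(λ₁ λ₂) = λ̄₁ + λ̄₂` and `det A⁻¹ = (λ₁ λ₂)⁻¹ = λ̄₁ λ̄₂`.  This is
`χ_{ρ^∨} = χ̄_ρ` for representations of finite groups.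
Ref: Serre, *Linear representations of finite groups*, §2.1 Prop. 1 (ii)–(iii) and §2.3. [folklore] -/
theorem charpoly_inv_eq_map_conj_of_pow_eq_one {A : Matrix (Fin 2) (Fin 2) ℂ} {m : ℕ} (hm : 0 < m)
    (hA : A ^ m = 1) : (A⁻¹).charpoly = A.charpoly.map (starRingEnd ℂ) := by
  have hs : A.charpoly.Splits := IsAlgClosed.splits _
  have hcard : A.charpoly.roots.card = 2 := by
    rw [← hs.natDegree_eq_card_roots, Matrix.charpoly_natDegree_eq_dim, Fintype.card_fin]
  obtain ⟨l₁, l₂, hR⟩ := Multiset.card_eq_two.mp hcard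
  have htr : A.trace = l₁ + l₂ := by
    rw [Matrix.trace_eq_sum_roots_charpoly_of_splits hs, hR]
    simp
  have hdet : A.det = l₁ * l₂ := by
    rw [Matrix.det_eq_prod_roots_charpoly_of_splits hs, hR]
    simp
  have h₁ : ‖l₁‖ = 1 :=
    norm_eq_one_of_mem_roots_charpoly_of_pow_eq_one hm hA (by rw [hR]; simp)
  have h₂ : ‖l₂‖ = 1 :=
    norm_eq_one_of_mem_roots_charpoly_of_pow_eq_one hm hA (by rw [hR]; simp)
  have hl₁ : l₁ ≠ 0 := fun h => by simp [h] at h₁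
  have hl₂ : l₂ ≠ 0 := fun h => by simp [h] at h₂
  -- trace and determinant of the inverse
  have hdet' : (A⁻¹).det = (starRingEnd ℂ) A.det := by
    rw [Matrix.det_nonsing_inv, Ring.inverse_eq_inv', hdet, mul_inv, map_mul,
      Complex.inv_eq_conj h₁, Complex.inv_eq_conj h₂]
  have htr' : (A⁻¹).trace = (starRingEnd ℂ) A.trace := by
    rw [Matrix.inv_def, Ring.inverse_eq_inv', Matrix.trace_smul, Matrix.adjugate_fin_two,
      Matrix.trace_fin_two, smul_eq_mul]
    simp only [Matrix.of_apply, Matrix.cons_val', Matrix.cons_val_zero, Matrix.cons_val_one,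
      Matrix.cons_val_fin_one]
    have : A 1 1 + A 0 0 = A.trace := by rw [Matrix.trace_fin_two, add_comm]
    rw [this, htr, hdet, map_add, ← Complex.inv_eq_conj h₁, ← Complex.inv_eq_conj h₂]
    field_simp
    ring
  rw [Matrix.charpoly_fin_two, Matrix.charpoly_fin_two, htr', hdet']
  simp only [Polynomial.map_add, Polynomial.map_sub, Polynomial.map_mul, Polynomial.map_pow,
    map_X, map_C]

end Matrix

namespace Literature.NumberTheory.GaloisRepresentations

/-! ### The dual of a framed representation: unramifiedness, Frobenius, oddness, finite image -/

section General

variable {G : Type*} [Group G] [TopologicalSpace G] {n : ℕ}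

/-- The dual of a finite-image framed representation has finite image
(`range ρ^∨ = (·ᵀ)⁻¹ '' range ρ`). [folklore] -/
theorem FramedRep.finite_range_dual {A : Type*} [CommRing A] [TopologicalSpace A]
    (ρ : FramedRep G A n) (hfin : (Set.range ρ).Finite) : (Set.range (FramedRep.dual ρ)).Finite := by
  have : Set.range (FramedRep.dual ρ) = glTransposeInv (Fin n) A '' Set.range ρ := by
    rw [← Set.range_comp]
    rfl
  rw [this]
  exact hfin.image _

/-- `det ((gᵀ)⁻¹) = (det g)⁻¹` in `GL_n`. [folklore] -/
theorem det_glTransposeInv {A : Type*} [CommRing A] [TopologicalSpace A] (g : GL (Fin n) A) :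
    Matrix.GeneralLinearGroup.det (glTransposeInv (Fin n) A g) =
      (Matrix.GeneralLinearGroup.det g)⁻¹ := by
  rw [← map_inv]
  refine Units.ext ?_
  simp only [Matrix.GeneralLinearGroup.val_det_apply, coe_glTransposeInv_apply,
    Matrix.det_transpose]

/-- Elements of finite order in `GL_n`: if `ρ` has finite image then every `ρ g` (as a matrix)
satisfies `(ρ g) ^ m = 1` for some `m > 0`. [folklore] -/
theorem FramedRep.exists_coe_pow_eq_one {A : Type*} [CommRing A] [TopologicalSpace A]
    (ρ : FramedRep G A n) (hfin : (Set.range ρ).Finite) (g : G) :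
    ∃ m : ℕ, 0 < m ∧ ((ρ g : GL (Fin n) A) : Matrix (Fin n) (Fin n) A) ^ m = 1 := by
  obtain ⟨m, hm, h⟩ := (isOfFinOrder_apply_of_finite_range ρ hfin g).exists_pow_eq_one
  exact ⟨m, hm, by rw [← Units.val_pow_eq_pow_val, h, Units.val_one]⟩

/-- **Characteristic polynomials of the dual (rank `2`, finite image).**  If `ρ : G → GL₂(ℂ)`
has finite image then `charpoly (ρ^∨ g) = conj (charpoly (ρ g))` for every `g`
(`ρ^∨ g = ((ρ g)⁻¹)ᵀ`, `Matrix.charpoly_transpose`,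
`Matrix.charpoly_inv_eq_map_conj_of_pow_eq_one`).
Ref: Serre, *Linear representations of finite groups*, §2.1 Prop. 1, §2.3. [folklore] -/
theorem FramedRep.charpoly_dual_of_finite_range (ρ : FramedRep G ℂ 2)
    (hfin : (Set.range ρ).Finite) (g : G) :
    FramedRep.charpoly (FramedRep.dual ρ) g = (FramedRep.charpoly ρ g).map (starRingEnd ℂ) := by
  obtain ⟨m, hm, hpow⟩ := ρ.exists_coe_pow_eq_one hfin g
  rw [FramedRep.charpoly, FramedRep.charpoly, FramedRep.coe_dual_apply, Matrix.charpoly_transpose,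
    Matrix.coe_units_inv]
  exact Matrix.charpoly_inv_eq_map_conj_of_pow_eq_one hm hpow

end General

section Galois

variable {K : Type*} [Field K] {n : ℕ}

/-- The dual of a framed Galois representation unramified at `v` is unramified at `v`. [folklore] -/
theorem FramedGaloisRep.isUnramifiedAt_dual {A : Type*} [CommRing A] [TopologicalSpace A]
    {v : HeightOneSpectrum (𝓞 K)} {ρ : FramedGaloisRep K A n} (h : ρ.IsUnramifiedAt v) :
    FramedGaloisRep.IsUnramifiedAt v (FramedRep.dual ρ) := by
  intro 𝔓 h𝔓 σ hσ
  change glTransposeInv (Fin n) A (ρ σ) = 1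
  rw [h 𝔓 h𝔓 σ hσ, map_one]

/-- **Frobenius on the dual.**  If `ρ : Γ_K → GL₂(ℂ)` has finite image and all arithmetic
Frobenii at `v` have characteristic polynomial `P` on `ρ`, then they have characteristic
polynomial `P̄ = P.map conj` on `ρ^∨`; e.g. `P = X² - a_p X + ε(p)` gives
`X² - ā_p X + ε̄(p)` ("`ρ̄`", Deligne–Serre 1974, §4 (b) (ii)).
Ref: Serre, *Linear representations of finite groups*, §2.3 (`χ^∨ = χ̄`). [folklore] -/
theorem FramedGaloisRep.hasFrobCharpolyAt_dual {v : HeightOneSpectrum (𝓞 K)}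
    {ρ : FramedGaloisRep K ℂ 2} (hfin : (Set.range ρ).Finite) {P : ℂ[X]}
    (h : ρ.HasFrobCharpolyAt v P) :
    FramedGaloisRep.HasFrobCharpolyAt v (P.map (starRingEnd ℂ)) (FramedRep.dual ρ) := by
  intro 𝔓 h𝔓 σ hσ
  rw [FramedRep.charpoly_dual_of_finite_range ρ hfin, h 𝔓 h𝔓 σ hσ]

/-- The dual of an odd framed Galois representation is odd: `det ρ^∨(c) = (det ρ(c))⁻¹ = -1`.
Ref: Deligne–Serre 1974, Rem. 4.5. [folklore] -/
theorem FramedGaloisRep.isOdd_dual {A : Type*} [CommRing A] [TopologicalSpace A]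
    {ρ : FramedGaloisRep K A n} (h : ρ.IsOdd) : FramedGaloisRep.IsOdd (FramedRep.dual ρ) := by
  intro φ c hc
  change Matrix.GeneralLinearGroup.det (glTransposeInv (Fin n) A (ρ c)) = -1
  rw [det_glTransposeInv, h φ c hc, inv_neg, inv_one]

end Galois

/-! ### Fixed vectors of a finite image: the averaging operator -/

namespace FramedRep

variable {G : Type*} [Group G] [TopologicalSpace G] {n : ℕ}

/-- **Fixed vectors by averaging.**  Let `ρ : G → GL_n(ℂ)` be a framed representation,
`H ≤ G`, and `T` a finite set of matrices enumerating the (finite) group `ρ(H)`.  Then the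
`H`-fixed vectors of the representation on column vectors are exactly the range of the
unnormalised averaging operator `P = Σ_{g ∈ T} g`: if `v` is fixed then `P v = #T · v`, and
`g P = P` for `g ∈ ρ(H)` shows that `P w` is fixed.
Ref: Serre, *Linear representations of finite groups*, §2.3 (proof of `dim V^G = (1/g) Σ χ(s)`).
[folklore] -/
theorem fixedSubmodule_eq_range_sum (ρ : FramedRep G ℂ n) (H : Subgroup G)
    (T : Finset (GL (Fin n) ℂ)) (hT : ∀ g, g ∈ T ↔ g ∈ H.map ρ.toMonoidHom) :
    ρ.toContinuousRep.fixedSubmodule H =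
      LinearMap.range (Matrix.mulVecLin (∑ g ∈ T, (g : Matrix (Fin n) (Fin n) ℂ))) := by
  set P : Matrix (Fin n) (Fin n) ℂ := ∑ g ∈ T, (g : Matrix (Fin n) (Fin n) ℂ) with hP
  have h1T : (1 : GL (Fin n) ℂ) ∈ T := (hT 1).mpr (one_mem _)
  -- `g P = P` for `g ∈ ρ(H)`
  have hinv : ∀ g ∈ T, (g : Matrix (Fin n) (Fin n) ℂ) * P = P := fun g hg => by
    have hg' : g ∈ H.map ρ.toMonoidHom := (hT g).mp hg
    rw [hP, Finset.mul_sum]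
    refine Finset.sum_equiv (Equiv.mulLeft g) (fun i => ?_) (fun i _ => ?_)
    · rw [hT, hT, Equiv.coe_mulLeft]
      constructor
      · exact fun hi => mul_mem hg' hi
      · intro hi
        have := mul_mem (inv_mem hg') hi
        rwa [inv_mul_cancel_left] at this
    · simp [Units.val_mul]
  ext v
  rw [ContinuousRep.mem_fixedSubmodule, LinearMap.mem_range]
  constructor
  · intro hv
    -- `P v = #T • v`
    have hPv : P *ᵥ v = (T.card : ℂ) • v := by
      rw [hP, Matrix.sum_mulVec]
      have : ∀ g ∈ T, (g : Matrix (Fin n) (Fin n) ℂ) *ᵥ v = v := fun g hg => by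
        obtain ⟨h, hh, rfl⟩ := Subgroup.mem_map.mp ((hT g).mp hg)
        exact hv h hh
      rw [Finset.sum_congr rfl this, Finset.sum_const, ← Nat.cast_smul_eq_nsmul ℂ]
    have hcard : (T.card : ℂ) ≠ 0 := Nat.cast_ne_zero.mpr (Finset.card_pos.mpr ⟨1, h1T⟩).ne'
    refine ⟨(T.card : ℂ)⁻¹ • v, ?_⟩
    rw [Matrix.mulVecLin_apply, Matrix.mulVec_smul, hPv, smul_smul, inv_mul_cancel₀ hcard,
      one_smul]
  · rintro ⟨w, rfl⟩ h hh
    have hmem : (ρ h : GL (Fin n) ℂ) ∈ T := (hT _).mpr ⟨h, hh, rfl⟩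
    rw [Matrix.mulVecLin_apply, FramedRep.toContinuousRep_apply_apply, Matrix.mulVec_mulVec,
      hinv _ hmem]

/-- For a finite-image framed representation, `dim V^H = rank (Σ_{g ∈ ρ(H)} g)` for any
finite set `T` of matrices enumerating `ρ(H)` (`Matrix.rank` = dimension of the range).
Ref: Serre, *Linear representations of finite groups*, §2.3. [folklore] -/
theorem finrank_fixedSubmodule_eq_rank (ρ : FramedRep G ℂ n) (H : Subgroup G)
    (T : Finset (GL (Fin n) ℂ)) (hT : ∀ g, g ∈ T ↔ g ∈ H.map ρ.toMonoidHom) :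
    finrank ℂ (ρ.toContinuousRep.fixedSubmodule H) =
      (∑ g ∈ T, (g : Matrix (Fin n) (Fin n) ℂ)).rank := by
  rw [ρ.fixedSubmodule_eq_range_sum H T hT]
  rfl

/-- A finite set of matrices enumerating `ρ(H)` exists when `ρ` has finite image. [folklore] -/
theorem exists_finset_image (ρ : FramedRep G ℂ n) (hfin : (Set.range ρ).Finite)
    (H : Subgroup G) : ∃ T : Finset (GL (Fin n) ℂ), ∀ g, g ∈ T ↔ g ∈ H.map ρ.toMonoidHom := by
  have hsub : ((H.map ρ.toMonoidHom : Subgroup (GL (Fin n) ℂ)) : Set (GL (Fin n) ℂ)) ⊆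
      Set.range ρ := by
    rintro g ⟨h, -, rfl⟩
    exact ⟨h, rfl⟩
  refine ⟨(hfin.subset hsub).toFinset, fun g => ?_⟩
  rw [Set.Finite.mem_toFinset, SetLike.mem_coe]

/-- **The dual has fixed spaces of the same dimension** (finite image): `ρ^∨(H)` is enumerated
by `{(gᵀ)⁻¹ : g ∈ T}`, whose sum is `(Σ_{g ∈ T} g⁻¹)ᵀ = (Σ_{g ∈ T} g)ᵀ` (inversion permutes the
group `ρ(H)`), of the same rank (`Matrix.rank_transpose`).  This is
`dim (V^*)^H = ⟨χ̄, 1⟩_H = ⟨χ, 1⟩_H = dim V^H`.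
Ref: Serre, *Linear representations of finite groups*, §2.3. [folklore] -/
theorem finrank_fixedSubmodule_dual (ρ : FramedRep G ℂ n) (hfin : (Set.range ρ).Finite)
    (H : Subgroup G) :
    finrank ℂ ((FramedRep.dual ρ).toContinuousRep.fixedSubmodule H) =
      finrank ℂ (ρ.toContinuousRep.fixedSubmodule H) := by
  classical
  obtain ⟨T, hT⟩ := ρ.exists_finset_image hfin H
  -- the image of `H` under the dual is `(·ᵀ)⁻¹ '' T`
  set T' : Finset (GL (Fin n) ℂ) := T.image (glTransposeInv (Fin n) ℂ) with hT'def
  have hT' : ∀ g, g ∈ T' ↔ g ∈ H.map (FramedRep.dual ρ).toMonoidHom := fun g => by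
    have hmap : H.map (FramedRep.dual ρ).toMonoidHom =
        (H.map ρ.toMonoidHom).map (glTransposeInv (Fin n) ℂ).toMonoidHom :=
      (Subgroup.map_map _ _ _).symm
    rw [hmap, hT'def, Finset.mem_image, Subgroup.mem_map]
    constructor
    · rintro ⟨x, hx, rfl⟩
      exact ⟨x, (hT x).mp hx, rfl⟩
    · rintro ⟨x, hx, rfl⟩
      exact ⟨x, (hT x).mpr hx, rfl⟩
  rw [ρ.finrank_fixedSubmodule_eq_rank H T hT, (FramedRep.dual ρ).finrank_fixedSubmodule_eq_rank H T' hT']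
  -- `Σ_{T'} g = (Σ_{T} g)ᵀ`
  have hinj : Function.Injective (glTransposeInv (Fin n) ℂ) := fun a b hab => by
    have := congrArg (glTransposeInv (Fin n) ℂ) hab
    have hinvol : ∀ c, glTransposeInv (Fin n) ℂ (glTransposeInv (Fin n) ℂ c) = c := fun c =>
      Units.ext (by simp [coe_glTransposeInv_apply, Matrix.transpose_nonsing_inv])
    rwa [hinvol, hinvol] at this
  have hsum : ∑ g ∈ T', (g : Matrix (Fin n) (Fin n) ℂ) =
      (∑ g ∈ T, (g : Matrix (Fin n) (Fin n) ℂ))ᵀ := by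
    rw [hT'def, Finset.sum_image fun a _ b _ hab => hinj hab, Matrix.transpose_sum]
    simp only [coe_glTransposeInv_apply]
    -- reindex by inversion in the group `ρ(H)`
    refine Finset.sum_equiv (Equiv.inv (GL (Fin n) ℂ)) (fun i => ?_) (fun i _ => ?_)
    · rw [hT, hT, Equiv.inv_apply]
      exact ⟨fun hi => inv_mem hi, fun hi => by simpa using inv_mem hi⟩
    · simp
  rw [hsum, Matrix.rank_transpose]

/-- Consequently all codimensions `codim V^H` of `ρ^∨` and `ρ` agree (finite image).
Ref: Serre, *Linear representations of finite groups*, §2.3; *Local Fields*, Ch. VI §2. [folklore] -/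
theorem codimFixed_dual (ρ : FramedRep G ℂ n) (hfin : (Set.range ρ).Finite) (H : Subgroup G) :
    (FramedRep.dual ρ).toContinuousRep.codimFixed H = ρ.toContinuousRep.codimFixed H := by
  rw [ContinuousRep.codimFixed_eq_finrank_sub, ContinuousRep.codimFixed_eq_finrank_sub,
    ρ.finrank_fixedSubmodule_dual hfin H]

end FramedRep

/-! ### The Artin conductor of the dual -/

namespace GaloisRep

variable {K : Type*} [Field K] [NumberField K] {A : Type*} [CommRing A] [TopologicalSpace A]
  {M : Type*} [AddCommGroup M] [Module A M] [TopologicalSpace M]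
  {M' : Type*} [AddCommGroup M'] [Module A M'] [TopologicalSpace M']

/-- The numerical Artin conductor sees a representation only through the codimensions
`codim V^H` of the fixed subspaces of the subgroups `H ≤ Γ_K` (inertia and upper ramification
groups): two Galois representations with the same `codim V^H` for all `H` have the same Swan
and Artin conductors at every prime, the same conductor ideal and the same numerical
conductor.  Ref: Serre, *Local Fields*, Ch. VI §2, Cor. 1' (the conductor as a function of the
`codim V^{G_i}`). [folklore] -/
theorem artinConductorNat_congr_codimFixed {ρ : GaloisRep K A M} {ρ' : GaloisRep K A M'}
    (h : ∀ H : Subgroup (absoluteGaloisGroup K), ρ.codimFixed H = ρ'.codimFixed H) :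
    ρ.artinConductorNat = ρ'.artinConductorNat := by
  unfold artinConductorNat artinConductor artinConductorExponent
  simp only [artinConductorAt_def, swanConductorAt_def, h]

end GaloisRep

/-- **The Artin conductor of the contragredient** (finite image): for a framed Galois
representation `ρ : Γ_K → GL_n(ℂ)` with finite image, `N 𝔣(ρ^∨) = N 𝔣(ρ)`
(`GaloisRep.artinConductorNat` of `FramedRep.dual ρ`), since `codim V^H` is the same for `ρ`
and `ρ^∨` for every `H` (`FramedRep.codimFixed_dual`).  In Deligne–Serre's proof of Thm. 4.6,
(ii), the same `M` serves as conductor of `ρ` and of `ρ̄ ≃ ρ^∨`.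
Ref: Serre, *Local Fields*, Ch. VI §2; Martinet, *Character theory and Artin L-functions*
(1977), §4 (`𝔣(χ̄) = 𝔣(χ)`). [folklore] -/
theorem FramedGaloisRep.artinConductorNat_dual {K : Type*} [Field K] [NumberField K] {n : ℕ}
    (ρ : FramedGaloisRep K ℂ n) (hfin : (Set.range ρ).Finite) :
    GaloisRep.artinConductorNat (FramedGaloisRep.toGaloisRep (FramedRep.dual ρ)) =
      GaloisRep.artinConductorNat ρ.toGaloisRep :=
  GaloisRep.artinConductorNat_congr_codimFixed fun H => FramedRep.codimFixed_dual ρ hfin H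

end Literature.NumberTheory.GaloisRepresentations
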